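import Mathlib
import HarnessLib
import Literature.Analysis.FluidPDE.SuitableWeak

/-!
# Route HardyPointSink — support `ABForwardHardy` (item stmt-NavierStokesRegularity-7983), file 2:
# the point-picking lemma (blow-up centres with controlled past)

Second helper file for the forward direction of Albritton–Barker 2019, Thm. 1.1 (blow-up at a
Type I singular point).  The printed argument (Seregin–Šverák 2009, §2, before Thm. 2.8) selects
running maxima `M(t_k) = |v(x_k, t_k)| → ∞` inside a cylinder on whose lateral shell the
solution is bounded (conditions (b9)–(b10)).  We replace the shell condition by a **point-picking
argument**: for a field `v` continuous on an open backward cylinder `U = Q(z₀, η)` and unbounded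
near its vertex, and for every `A > 0`, `M₀`, there is a centre `z* ∈ U` with
`M* = ‖v(z*)‖ ≥ M₀` such that the closed parabolic box of radius `A / M*` around `z*` lies in
`U` and `‖v‖ ≤ 2 M*` on `Q(z*, A / M*)` (`exists_blowup_centre`).  After the Navier–Stokes
rescaling by `λ = 1/(2M*)` around `z*` this is a field bounded by `1` on `Q(0, 2A)` with value of
norm `1/2` at the vertex — the input of the compactness step.  Proof: maximise
`W(w) = ‖v(w)‖ · δ(w)` over a compact box `H ⊆ U` hanging from a point `ẑ` of large norm, where
`δ(w)` is the parabolic distance from `w` to the bottom and lateral boundary of `H`; at a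
maximiser `z*`, `W(z*) ≥ W(ẑ) = 2A`, and on `Q(z*, δ(z*)/2)` one has `δ ≥ δ(z*)/2`, whence
`‖v‖ ≤ 2 ‖v(z*)‖` there.  (Pure real analysis; no Navier–Stokes input.)

## References

* G. Seregin, V. Šverák, Comm. PDE 34 (2009) = arXiv:0804.1803, §2 (selection of `x_k, t_k`).
* D. Albritton, T. Barker, J. Math. Fluid Mech. 21 (2019) = arXiv:1811.00502, §3.
-/

noncomputable section

open Set Function Filter Metric TopologicalSpace
open scoped Topology
open Literature.Analysis.FluidPDE

-- single-problem summit: the namespace repeats the summit name by design (CONVENTIONS §1)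
set_option linter.dupNamespace false

namespace Summit.NavierStokesRegularity.NavierStokesRegularity.Theorems.HardyPointSinkABForwardHardy

local notation "E³" => EuclideanSpace ℝ (Fin 3)

/-- **Point picking.**  Let `v` be continuous on the open backward cylinder `Q(z₀, η)` and
unbounded near its vertex (`‖v‖` exceeds every bound on every `Q(z₀, min ρ η)`).  Then for every
`A > 0` and `M₀` there is `z* ∈ Q(z₀, η)` with `‖v z*‖ ≥ M₀`, `‖v z*‖ > 0`, the closed parabolic
box of radius `A / ‖v z*‖` hanging from `z*` inside `Q(z₀, η)`, and `‖v‖ ≤ 2 ‖v z*‖` on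
`Q(z*, A / ‖v z*‖)`. -/
theorem exists_blowup_centre {v : ℝ × E³ → E³} {z₀ : ℝ × E³} {η : ℝ} (hη : 0 < η)
    (hvc : ContinuousOn v (parabolicCylinder η z₀))
    (hub : ∀ ρ : ℝ, 0 < ρ → ∀ M : ℝ, ∃ w ∈ parabolicCylinder (min ρ η) z₀, M < ‖v w‖)
    {A : ℝ} (hA : 0 < A) (M₀ : ℝ) :
    ∃ zs : ℝ × E³, zs ∈ parabolicCylinder η z₀ ∧ M₀ ≤ ‖v zs‖ ∧ 0 < ‖v zs‖ ∧
      Icc (zs.1 - (A / ‖v zs‖) ^ 2) zs.1 ×ˢ closedBall zs.2 (A / ‖v zs‖) ⊆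
        parabolicCylinder η z₀ ∧
      ∀ w ∈ parabolicCylinder (A / ‖v zs‖) zs, ‖v w‖ ≤ 2 * ‖v zs‖ := by
  -- ## a point `ẑ` of large norm close to the vertex
  set M₁ : ℝ := max (max M₀ 1) (4 * A / η) with hM₁
  obtain ⟨zh, hzh, hMzh⟩ := hub (η / 2) (by linarith) M₁
  have hmin : min (η / 2) η = η / 2 := min_eq_left (by linarith)
  rw [hmin, mem_parabolicCylinder] at hzh
  obtain ⟨⟨hzh1, hzh2⟩, hzh3⟩ := hzh
  set Mh : ℝ := ‖v zh‖ with hMh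
  have hMh1 : 1 ≤ Mh := by
    have : (1 : ℝ) ≤ M₁ := (le_max_right _ _).trans (le_max_left _ _)
    linarith
  have hMh0 : 0 < Mh := by linarith
  have hMhM₀ : M₀ ≤ Mh := by
    have : M₀ ≤ M₁ := (le_max_left _ _).trans (le_max_left _ _)
    linarith
  have hMhA : 4 * A / η < Mh := lt_of_le_of_lt (le_max_right _ _) hMzh
  -- ## the box `H` of radius `d = 2A / M̂` hanging from `ẑ`
  set d : ℝ := 2 * A / Mh with hd
  have hd0 : 0 < d := by positivity
  have hdη : d < η / 2 := by
    rw [hd, div_lt_iff₀ hMh0]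
    rw [div_lt_iff₀ hη] at hMhA
    linarith
  set H : Set (ℝ × E³) := Icc (zh.1 - d ^ 2) zh.1 ×ˢ closedBall zh.2 d with hH
  have hHc : IsCompact H := isCompact_Icc.prod (isCompact_closedBall _ _)
  have hHU : H ⊆ parabolicCylinder η z₀ := by
    rintro w ⟨⟨hw1, hw2⟩, hw3⟩
    rw [mem_closedBall] at hw3
    rw [mem_parabolicCylinder]
    refine ⟨⟨?_, by linarith⟩, ?_⟩
    · have : d ^ 2 < η ^ 2 / 4 := by nlinarith
      nlinarith
    · calc dist w.2 z₀.2 ≤ dist w.2 zh.2 + dist zh.2 z₀.2 := dist_triangle _ _ _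
        _ < d + η / 2 := by linarith
        _ < η := by linarith
  have hzhH : zh ∈ H := ⟨⟨by nlinarith, le_rfl⟩, mem_closedBall_self hd0.le⟩
  -- ## the weight `δ` and the functional `W = ‖v‖ δ`
  set δ : ℝ × E³ → ℝ := fun w => min (d - dist w.2 zh.2) (Real.sqrt (w.1 - (zh.1 - d ^ 2)))
    with hδ
  have hδc : Continuous δ :=
    (continuous_const.sub (continuous_snd.dist continuous_const)).min
      (Real.continuous_sqrt.comp (continuous_fst.sub continuous_const))
  have hδle : ∀ w, δ w ≤ d := fun w =>
    (min_le_left _ _).trans (by linarith [dist_nonneg (x := w.2) (y := zh.2)])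
  have hδzh : δ zh = d := by
    show min (d - dist zh.2 zh.2) (Real.sqrt (zh.1 - (zh.1 - d ^ 2))) = d
    rw [dist_self, sub_zero, show zh.1 - (zh.1 - d ^ 2) = d ^ 2 by ring,
      Real.sqrt_sq hd0.le, min_self]
  set W : ℝ × E³ → ℝ := fun w => ‖v w‖ * δ w with hW
  have hWc : ContinuousOn W H := (hvc.mono hHU).norm.mul hδc.continuousOn
  -- ## a maximiser `z*` of `W` on `H`
  obtain ⟨zs, hzsH, hmax⟩ := hHc.exists_isMaxOn ⟨zh, hzhH⟩ hWc
  have hWzh : W zh = 2 * A := by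
    show ‖v zh‖ * δ zh = 2 * A
    have hne : ‖v zh‖ ≠ 0 := by rw [← hMh]; exact hMh0.ne'
    rw [hδzh, hd, hMh]
    field_simp
  have hWzs : 2 * A ≤ W zs := hWzh ▸ hmax hzhH
  set Ms : ℝ := ‖v zs‖ with hMs
  set δs : ℝ := δ zs with hδs
  have hWzs' : 2 * A ≤ Ms * δs := hWzs
  have hδs0 : 0 < δs := by
    by_contra h
    push Not at h
    have : Ms * δs ≤ 0 := mul_nonpos_of_nonneg_of_nonpos (norm_nonneg _) h
    linarith
  have hMs0 : 0 < Ms := by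
    by_contra h
    push Not at h
    have : Ms * δs ≤ 0 := mul_nonpos_of_nonpos_of_nonneg h hδs0.le
    linarith
  have hδsd : δs ≤ d := hδle zs
  -- `M* ≥ M̂`
  have hMsMh : Mh ≤ Ms := by
    have h1 : 2 * A ≤ Ms * d := hWzs'.trans (mul_le_mul_of_nonneg_left hδsd hMs0.le)
    have h2 : Ms * d = 2 * A * (Ms / Mh) := by rw [hd]; ring
    rw [h2] at h1
    have h3 : 1 ≤ Ms / Mh := by
      by_contra h4
      push Not at h4
      nlinarith
    rwa [le_div_iff₀ hMh0, one_mul] at h3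
  -- the radius `r* = A / M* ≤ δ*/2`
  set rs : ℝ := A / Ms with hrs
  have hrs0 : 0 < rs := by positivity
  have hrsδ : rs ≤ δs / 2 := by
    rw [hrs, div_le_iff₀ hMs0]
    linarith
  -- ## geometry of `z*` inside `H`
  obtain ⟨⟨hzs1, hzs2⟩, hzs3⟩ := hzsH
  rw [mem_closedBall] at hzs3
  have hδs1 : δs ≤ d - dist zs.2 zh.2 := min_le_left _ _
  have hδs2 : δs ^ 2 ≤ zs.1 - (zh.1 - d ^ 2) := by
    have h1 : δs ≤ Real.sqrt (zs.1 - (zh.1 - d ^ 2)) := min_le_right _ _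
    have h2 : 0 < Real.sqrt (zs.1 - (zh.1 - d ^ 2)) := hδs0.trans_le h1
    have h3 : 0 < zs.1 - (zh.1 - d ^ 2) := Real.sqrt_pos.1 h2
    calc δs ^ 2 ≤ Real.sqrt (zs.1 - (zh.1 - d ^ 2)) ^ 2 := pow_le_pow_left₀ hδs0.le h1 2
      _ = zs.1 - (zh.1 - d ^ 2) := Real.sq_sqrt h3.le
  -- points `w` with `z*.1 - (δ*/2)² < w.1 ≤ z*.1`, `dist w.2 z*.2 ≤ δ*/2` are in `H` with `δ ≥ δ*/2`
  have hkey : ∀ w : ℝ × E³, zs.1 - (δs / 2) ^ 2 < w.1 → w.1 ≤ zs.1 → dist w.2 zs.2 ≤ δs / 2 →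
      w ∈ H ∧ δs / 2 ≤ δ w := by
    intro w hw1 hw2 hw3
    have hdist : dist w.2 zh.2 ≤ d - δs / 2 := by
      calc dist w.2 zh.2 ≤ dist w.2 zs.2 + dist zs.2 zh.2 := dist_triangle _ _ _
        _ ≤ δs / 2 + (d - δs) := by linarith
        _ = d - δs / 2 := by ring
    have hsq : (δs / 2) ^ 2 = δs ^ 2 / 4 := by ring
    have htime : (δs / 2) ^ 2 ≤ w.1 - (zh.1 - d ^ 2) := by
      linarith only [hw1, hsq, hδs2, sq_nonneg δs]
    have htime' : zh.1 - d ^ 2 ≤ w.1 := by linarith only [htime, sq_nonneg (δs / 2)]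
    have hball : dist w.2 zh.2 ≤ d := by linarith only [hdist, hδs0]
    have hδ1 : δs / 2 ≤ d - dist w.2 zh.2 := by linarith only [hdist]
    refine ⟨⟨⟨htime', hw2.trans hzs2⟩, mem_closedBall.2 hball⟩, le_min hδ1 ?_⟩
    calc δs / 2 = Real.sqrt ((δs / 2) ^ 2) := (Real.sqrt_sq (by linarith)).symm
      _ ≤ Real.sqrt (w.1 - (zh.1 - d ^ 2)) := Real.sqrt_le_sqrt htime
  -- the same for the CLOSED box of radius `r* < δ*` (time bound through `r*² < δ*²`)
  have hkey' : ∀ w : ℝ × E³, zs.1 - rs ^ 2 ≤ w.1 → w.1 ≤ zs.1 → dist w.2 zs.2 ≤ rs → w ∈ H := by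
    intro w hw1 hw2 hw3
    have hdist : dist w.2 zh.2 ≤ d - δs / 2 := by
      calc dist w.2 zh.2 ≤ dist w.2 zs.2 + dist zs.2 zh.2 := dist_triangle _ _ _
        _ ≤ δs / 2 + (d - δs) := by linarith
        _ = d - δs / 2 := by ring
    have hr2 : rs ^ 2 ≤ (δs / 2) ^ 2 := pow_le_pow_left₀ hrs0.le hrsδ 2
    have hsq : (δs / 2) ^ 2 = δs ^ 2 / 4 := by ring
    have htime : zh.1 - d ^ 2 ≤ w.1 := by linarith only [hw1, hr2, hsq, hδs2, sq_nonneg δs]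
    have hball : dist w.2 zh.2 ≤ d := by linarith only [hdist, hδs0]
    exact ⟨⟨htime, hw2.trans hzs2⟩, mem_closedBall.2 hball⟩
  refine ⟨zs, hHU ⟨⟨hzs1, hzs2⟩, mem_closedBall.2 hzs3⟩, hMhM₀.trans hMsMh, hMs0, ?_, ?_⟩
  · -- the closed box of radius `r*` lies in `H ⊆ U`
    rintro w ⟨⟨hw1, hw2⟩, hw3⟩
    rw [mem_closedBall] at hw3
    exact hHU (hkey' w hw1 hw2 hw3)
  · intro w hw
    rw [mem_parabolicCylinder] at hw
    obtain ⟨⟨hw1, hw2⟩, hw3⟩ := hw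
    have h2 : rs ^ 2 ≤ (δs / 2) ^ 2 := pow_le_pow_left₀ hrs0.le hrsδ 2
    obtain ⟨hwH, hδw⟩ := hkey w (by linarith) hw2.le (hw3.le.trans hrsδ)
    have hδw0 : 0 < δ w := by linarith
    have hWw : W w ≤ W zs := hmax hwH
    have hWw' : ‖v w‖ * δ w ≤ Ms * δs := hWw
    have : ‖v w‖ * δ w ≤ (2 * Ms) * δ w := by
      calc ‖v w‖ * δ w ≤ Ms * δs := hWw'
        _ ≤ Ms * (2 * δ w) := mul_le_mul_of_nonneg_left (by linarith) hMs0.le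
        _ = (2 * Ms) * δ w := by ring
    exact le_of_mul_le_mul_right this hδw0

end Summit.NavierStokesRegularity.NavierStokesRegularity.Theorems.HardyPointSinkABForwardHardy

end
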